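import Summits.BirchSwinnertonDyer.BirchSwinnertonDyer.Theorems.ByReductionTypeAtTwoTowerLevelOne
import Summits.BirchSwinnertonDyer.BirchSwinnertonDyer.Theorems.ByReductionTypeAtTwoTowerLayerRank
import HarnessLib

/-!
# The LEVEL-ONE tower door with its layer-`ℚ` input read off a `2`-descent over `ℚ`:
# `2^n ≤ #Sel_{2^∞}(E/ℚ)[2]` + `#X/(2,T²)X ≤ 2^n` ⇒ `TowerGapAtTwo W`, the `2`-adic IMC, the Kato half,
# `BSD(E,2)` (route ByReductionTypeAtTwo, crux `OrdKatoHalfAtTwo`, item stmt-BirchSwinnertonDyer-19271;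
# seat bsd-2adic-ord-2, GEN 2)

HONEST FRAMING (cell `bsd-2adic`, run/shared/lean/pub/bsd-2adic/, HUMAN RULINGS D-0036/D-0074): THEOREMS
ONLY; nothing asserted; no definition; no new named fact; closes nothing by itself.

Composition of two landed files: `…TowerLevelOne` (this seat, p427057: the level-one certificate in
MODULE form `{2^n ≤ #X/(2,T)X, #X/(2,T²)X ≤ 2^n}` gives the gap `(m,k) = (1,1)`) and `…TowerLayerRank`
(seat bsd-2adic-tower-1, p424818: `#Sel_{2^∞}(E/ℚ_j)[2] ≤ #X/(2,T^{2^j})X` when `E(ℚ)[2] = 0`, Greenberg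
§1 p. 60 / §3 pp. 85–86 in the tree's currency). Result: on a curve with ODD torsion order the layer-`ℚ`
half of the level-one certificate is a `2`-DESCENT OVER `ℚ` — `2^n ≤ #Sel_{2^∞}(E/ℚ)[2]`, i.e. `n ≤ d₀`,
`d₀ = dim_{𝔽₂} Sel₂(E/ℚ)` (`= dim Ш(E/ℚ)[2]` at rank `0`) — and the only input above `ℚ` is ONE upper
bound `#X/(2,T²)X ≤ 2^n` at the layer `ℚ(√2)` (`(2,ω_1) = (2,T²)`).

* `towerGapAtTwo_of_layerZero_of_levelOne`: {`2 ∤ #E(ℚ)_tors`, `2^n ≤ #Sel_{2^∞}(E/ℚ)[2]`,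
  `#X/(2,T²)X ≤ 2^n` for every cyclotomic datum} ⇒ `TowerGapAtTwo W`;
* doors `mazurMainConjecture_two_of_layerZero_of_levelOne`, `katoHalfAt_two_of_layerZero_of_levelOne`
  (= the item `OrdKatoHalfAtTwo` AT `W`), `bsdp_two_of_layerZero_of_levelOne`: PRINT {Kato 17.4 (1)(2)@2,
  Greenberg Prop. 4.14@2; at rank 0 also Greenberg Thm. 4.1@2 (`hEC`, δ = 0), modularity, GZK} +
  certificates {`hper₀`, `2^n ≤ #Sel_{2^∞}(E/ℚ)[2]`, `#X/(2,T²)X ≤ 2^n`, `μ_an = 0`, `λ_an = n`};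
* ADDENDUM (same seat): the ITEM at `W` from the COUNTS ALONE — `katoHalfAt_two_of_levelOne_counts`
  (module form), `katoHalfAt_two_of_layerPair_counts` (two consecutive layers),
  `katoHalfAt_two_of_layerZero_of_levelOne_counts` (layer-`ℚ` form): Kato 17.4 (1)(2)@2 + `hper₀` +
  the counts ⇒ `MainConjectureLowerDivisibilityAtTwoOrd W`, because `μ = 0` alone upgrades Kato's
  `Λ[1/2]`-divisibility to `Λ` (tree `mainConjectureLowerDivisibilityAtTwoOrd_of_towerGapAtTwo`); no
  `λ_an`/`μ_an` certificate, no Prop. 4.14 (those enter only the IMC / `BSD(E,2)` doors).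

READING (nothing asserted): on the 440 open good-ordinary classes with `E[2]` irreducible, `d₀ = 2`
throughout (cell sha-1 level census × this seat's census), so `n = λ_an = 2` is where this door applies as
typed (80 classes); wherever `dim_{𝔽₂} X/(2,T)X = λ_an` it applies with the module-form file. WHAT IS STILL
MISSING: the upper-half bridge `#X/(2,ω_1)X ≤ #A_1[2]` (seat bsd-2adic-tower-1) and a generalised `2`-descent
over `ℚ(√2)` (seat bsd-2adic-tower-eng).

References: R. Greenberg, LNM 1716 (1999), §1 p. 60, §3 pp. 85–91, Thm. 4.1, Prop. 4.14; L. Washington,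
*Introduction to Cyclotomic Fields*, §13.2; K. Kato, Astérisque 295 (2004), Thm. 17.4.
-/

set_option autoImplicit false

noncomputable section

open scoped Classical MatrixGroups ModularForm

open CongruenceSubgroup WeierstrassCurve Literature.NumberTheory.EllipticCurves
  Literature.NumberTheory.EllipticCurves.ModularForms Literature.NumberTheory.EllipticCurves.Rank1Residual
  Literature.NumberTheory.EllipticCurves.Rank1Residual.Typed
  Literature.NumberTheory.EllipticCurves.Greenberg1999
  Summit.BirchSwinnertonDyer.Rank1Residual.X1.MuLambda
  Summit.BirchSwinnertonDyer.Rank1Residual.X1.MuPart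
  Summit.BirchSwinnertonDyer.Rank1Residual.X1.ParitySqueeze
  Summit.BirchSwinnertonDyer.BirchSwinnertonDyer.Theorems.Rank1ResidualX1Defs
  Summit.BirchSwinnertonDyer.Rank1Residual.X5 Summit.BirchSwinnertonDyer.Rank1Residual.X5.O1
  Summit.BirchSwinnertonDyer.Rank1Residual.X5.TowerGap
  Summit.BirchSwinnertonDyer.Rank1Residual

namespace Summit.BirchSwinnertonDyer.BirchSwinnertonDyer.Theorems.KatoHalfPinch

section Curve

variable (W : WeierstrassCurve ℚ) [W.IsElliptic] [W.IsGloballyMinimal]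

omit [W.IsGloballyMinimal] in
/-- **Layer `ℚ` ⇒ module form.** On a curve with odd torsion order (`E(ℚ)[2] = 0`), the `2`-descent
datum `2^n ≤ #Sel_{2^∞}(E/ℚ)[2]` gives `2^n ≤ #X/(2,T)X` for every cyclotomic datum (tree:
`finite_and_natCard_selmerLayer_pTorsion_le` at layer `0`, `(2,ω_0) = (2,T)`).
[cite: GreenbergLNM1716, §1 p. 60 and §3 pp. 85–86] -/
theorem towerLowOne_of_layerZero (htors : ¬ 2 ∣ W.torsionOrder) {n : ℕ}
    (hsel₀ : ∀ κ : ZpExtension ℚ 2, κ.IsCyclotomic →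
      2 ^ n ≤ Nat.card {z : W.selmerLayer κ 0 // 2 • z = 0}) :
    ∀ (κ : ZpExtension ℚ 2) (γ : Field.absoluteGaloisGroup ℚ), κ.IsCyclotomic →
      κ.IsTopGenerator γ → IsCyclotomicVariable 2 γ → ∀ D : W.SelmerDualData κ γ,
      2 ^ n ≤ Nat.card (D.X ⧸ (towerIdeal 2 1 • ⊤ : Submodule (IwasawaAlgebra 2) D.X)) := by
  intro κ γ hκ hγ _ D
  haveI : Module.Finite (IwasawaAlgebra 2) D.X := D.module_finite_holds hγ
  have hK := Iwasawa.forall_smul_eq_zero_imp_of_not_dvd_torsionOrder W htors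
  have h0 := (finite_and_natCard_selmerLayer_pTorsion_le W κ D hK 0).2
  rw [pow_zero] at h0
  exact (hsel₀ κ hκ).trans h0

omit [W.IsGloballyMinimal] in
/-- **The LEVEL-ONE certificate with its layer-`ℚ` half read off a `2`-descent over `ℚ` gives the tower
gap**: `2 ∤ #E(ℚ)_tors`, `2^n ≤ #Sel_{2^∞}(E/ℚ)[2]`, and `#X/(2,T²)X ≤ 2^n` for every cyclotomic datum ⇒
`TowerGapAtTwo W` (gap `(1,1)`). [cite: GreenbergLNM1716, §1 p. 60 and §3 pp. 85–86]
[cite: Washington1997, §13.2] -/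
theorem towerGapAtTwo_of_layerZero_of_levelOne (htors : ¬ 2 ∣ W.torsionOrder) {n : ℕ}
    (hsel₀ : ∀ κ : ZpExtension ℚ 2, κ.IsCyclotomic →
      2 ^ n ≤ Nat.card {z : W.selmerLayer κ 0 // 2 • z = 0})
    (hup₂ : ∀ (κ : ZpExtension ℚ 2) (γ : Field.absoluteGaloisGroup ℚ), κ.IsCyclotomic →
      κ.IsTopGenerator γ → IsCyclotomicVariable 2 γ → ∀ D : W.SelmerDualData κ γ,
      Nat.card (D.X ⧸ (towerIdeal 2 2 • ⊤ : Submodule (IwasawaAlgebra 2) D.X)) ≤ 2 ^ n) :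
    TowerGapAtTwo W :=
  towerGapAtTwo_of_levelOne W (towerLowOne_of_layerZero W htors hsel₀) hup₂

/-- **Door (TOWER, level one, layer-`ℚ` form): `MazurMainConjecture W 2`** on a good-ordinary-at-`2`
curve with odd torsion order: PRINT {Kato 17.4 (1)(2)@2, Greenberg Prop. 4.14@2} + certificates
{`hper₀`, `2^n ≤ #Sel_{2^∞}(E/ℚ)[2]`, `#X/(2,T²)X ≤ 2^n`, `μ_an = 0`, `λ_an = n`}.
[cite: Kato2004Asterisque, Thm. 17.4 (1)(2) (p. 273)] [cite: GreenbergLNM1716, Prop. 4.14 (§4)]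
[cite: GreenbergVatsal2000, p. 4 (after Thm. (1.2))] -/
theorem mazurMainConjecture_two_of_layerZero_of_levelOne
    (h17 : ∀ [NeZero (W.conductorNorm ℤ)] (f : CuspForm (Gamma0 (W.conductorNorm ℤ)) 2),
      kato_divisibility_allPrimes W 2 (f := f))
    (h414 : prop414_noFiniteSubmodule_of_not_dvd_torsionOrder)
    (hper₀ : ∀ [NeZero (W.conductorNorm ℤ)] (f : CuspForm (Gamma0 (W.conductorNorm ℤ)) 2),
      IsNewformOf W f → ∀ ϖ : ℚ, (ϖ : ℝ) * W.realPeriodRat = plusPeriod f → 0 ≤ padicValRat 2 ϖ)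
    (hgo : GoodOrd W 2) (htors : ¬ 2 ∣ W.torsionOrder) {n : ℕ}
    (hsel₀ : ∀ κ : ZpExtension ℚ 2, κ.IsCyclotomic →
      2 ^ n ≤ Nat.card {z : W.selmerLayer κ 0 // 2 • z = 0})
    (hup₂ : ∀ (κ : ZpExtension ℚ 2) (γ : Field.absoluteGaloisGroup ℚ), κ.IsCyclotomic →
      κ.IsTopGenerator γ → IsCyclotomicVariable 2 γ → ∀ D : W.SelmerDualData κ γ,
      Nat.card (D.X ⧸ (towerIdeal 2 2 • ⊤ : Submodule (IwasawaAlgebra 2) D.X)) ≤ 2 ^ n)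
    (hlan : AnalyticLambdaEq W 2 n) (hμan : AnalyticMuLE W 2 0) : MazurMainConjecture W 2 :=
  mazurMainConjecture_two_of_levelOne W h17 h414 hper₀ hgo htors
    (towerLowOne_of_layerZero W htors hsel₀) hup₂ hlan hμan

/-- **The Kato–Néron half (the item `OrdKatoHalfAtTwo` AT `W`), level-one layer-`ℚ` form.**
[cite: Kato2004Asterisque, Thm. 17.4 (1)(2) (p. 273)] [cite: GreenbergLNM1716, Prop. 4.14 (§4)] -/
theorem katoHalfAt_two_of_layerZero_of_levelOne
    (h17 : ∀ [NeZero (W.conductorNorm ℤ)] (f : CuspForm (Gamma0 (W.conductorNorm ℤ)) 2),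
      kato_divisibility_allPrimes W 2 (f := f))
    (h414 : prop414_noFiniteSubmodule_of_not_dvd_torsionOrder)
    (hper₀ : ∀ [NeZero (W.conductorNorm ℤ)] (f : CuspForm (Gamma0 (W.conductorNorm ℤ)) 2),
      IsNewformOf W f → ∀ ϖ : ℚ, (ϖ : ℝ) * W.realPeriodRat = plusPeriod f → 0 ≤ padicValRat 2 ϖ)
    (hgo : GoodOrd W 2) (htors : ¬ 2 ∣ W.torsionOrder) {n : ℕ}
    (hsel₀ : ∀ κ : ZpExtension ℚ 2, κ.IsCyclotomic →
      2 ^ n ≤ Nat.card {z : W.selmerLayer κ 0 // 2 • z = 0})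
    (hup₂ : ∀ (κ : ZpExtension ℚ 2) (γ : Field.absoluteGaloisGroup ℚ), κ.IsCyclotomic →
      κ.IsTopGenerator γ → IsCyclotomicVariable 2 γ → ∀ D : W.SelmerDualData κ γ,
      Nat.card (D.X ⧸ (towerIdeal 2 2 • ⊤ : Submodule (IwasawaAlgebra 2) D.X)) ≤ 2 ^ n)
    (hlan : AnalyticLambdaEq W 2 n) (hμan : AnalyticMuLE W 2 0) :
    MainConjectureLowerDivisibilityAtTwoOrd W :=
  katoHalfAt_two_of_levelOne W h17 h414 hper₀ hgo htors
    (towerLowOne_of_layerZero W htors hsel₀) hup₂ hlan hμan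

/-- **Door (TOWER, level one, layer-`ℚ` form) for `BSD(E,2)` at analytic rank `0`**: PRINT {modularity,
GZK, Kato 17.4 (1)(2)@2, Greenberg Thm. 4.1@2 (`hEC`, δ = 0), Greenberg Prop. 4.14@2} + certificates
{`hper₀`, `2^n ≤ #Sel_{2^∞}(E/ℚ)[2]`, `#X/(2,T²)X ≤ 2^n`, `μ_an = 0`, `λ_an = n`} ⇒ `BSDp W 2`.
[cite: GreenbergLNM1716, Thm. 4.1 (p. 102), Prop. 4.14 (§4)]
[cite: Kato2004Asterisque, Thm. 17.4 (1)(2) (p. 273)] [cite: Miller2011LMS, Def. 1.1] -/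
theorem bsdp_two_of_layerZero_of_levelOne (hmod : nonempty_modularParametrizationData)
    (hGZK : rank_eq_analyticRank_of_analyticRank_le_one)
    (h17 : ∀ [NeZero (W.conductorNorm ℤ)] (f : CuspForm (Gamma0 (W.conductorNorm ℤ)) 2),
      kato_divisibility_allPrimes W 2 (f := f))
    (hEC : TwoAdicEulerCharRankZero W 0) (h414 : prop414_noFiniteSubmodule_of_not_dvd_torsionOrder)
    (hper₀ : ∀ [NeZero (W.conductorNorm ℤ)] (f : CuspForm (Gamma0 (W.conductorNorm ℤ)) 2),
      IsNewformOf W f → ∀ ϖ : ℚ, (ϖ : ℝ) * W.realPeriodRat = plusPeriod f → 0 ≤ padicValRat 2 ϖ)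
    (hgo : GoodOrd W 2) (hr : W.analyticRank = 0) (htors : ¬ 2 ∣ W.torsionOrder) {n : ℕ}
    (hsel₀ : ∀ κ : ZpExtension ℚ 2, κ.IsCyclotomic →
      2 ^ n ≤ Nat.card {z : W.selmerLayer κ 0 // 2 • z = 0})
    (hup₂ : ∀ (κ : ZpExtension ℚ 2) (γ : Field.absoluteGaloisGroup ℚ), κ.IsCyclotomic →
      κ.IsTopGenerator γ → IsCyclotomicVariable 2 γ → ∀ D : W.SelmerDualData κ γ,
      Nat.card (D.X ⧸ (towerIdeal 2 2 • ⊤ : Submodule (IwasawaAlgebra 2) D.X)) ≤ 2 ^ n)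
    (hlan : AnalyticLambdaEq W 2 n) (hμan : AnalyticMuLE W 2 0) : BSDp W 2 :=
  bsdp_two_of_levelOne W hmod hGZK h17 hEC h414 hper₀ hgo hr htors
    (towerLowOne_of_layerZero W htors hsel₀) hup₂ hlan hμan

/-! ## ADDENDUM (same seat): the item `OrdKatoHalfAtTwo` AT `W` from the counts ALONE -/

/-- **The Kato–Néron half at `W` (the item `OrdKatoHalfAtTwo` AT `W`) from the LEVEL-ONE counts
alone (module form).** Good ordinary `2`; PRINT: Kato 17.4 (1)(2)@2 (`h17`); certificates: Néron
integrality `hper₀` (`0 ≤ ord₂ ϖ`, so `ϖ·L₂(f,α) = ι L₀`), and for every cyclotomic datum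
`2^n ≤ #X/(2,T)X` and `#X/(2,T²)X ≤ 2^n`. Then `char_Λ X ∣ ϖ·L₂` INTEGRALLY: the level-one gap gives `X`
torsion with `μ(X) = 0` (`towerGapAtTwo_of_levelOne`), and `μ = 0` upgrades Kato's divisibility in
`Λ[1/2]` to `Λ` (tree `O1.mainConjectureLowerDivisibilityAtTwoOrd_of_towerGapAtTwo`). NO `λ_an`/`μ_an`
certificate, NO Greenberg 4.14, NO torsion hypothesis, any analytic rank — the minimal per-class form
of the item (the `λ`-side inputs are needed only for the full IMC and `BSD(E,2)`).
[cite: Kato2004Asterisque, Thm. 17.4 (1)(2) (p. 273)] [cite: MazurTateTeitelbaum1986Invent, §I.12] -/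
theorem katoHalfAt_two_of_levelOne_counts
    (h17 : ∀ [NeZero (W.conductorNorm ℤ)] (f : CuspForm (Gamma0 (W.conductorNorm ℤ)) 2),
      kato_divisibility_allPrimes W 2 (f := f))
    (hper₀ : ∀ [NeZero (W.conductorNorm ℤ)] (f : CuspForm (Gamma0 (W.conductorNorm ℤ)) 2),
      IsNewformOf W f → ∀ ϖ : ℚ, (ϖ : ℝ) * W.realPeriodRat = plusPeriod f → 0 ≤ padicValRat 2 ϖ)
    (hgo : GoodOrd W 2) {n : ℕ}
    (hlow₁ : ∀ (κ : ZpExtension ℚ 2) (γ : Field.absoluteGaloisGroup ℚ), κ.IsCyclotomic →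
      κ.IsTopGenerator γ → IsCyclotomicVariable 2 γ → ∀ D : W.SelmerDualData κ γ,
      2 ^ n ≤ Nat.card (D.X ⧸ (towerIdeal 2 1 • ⊤ : Submodule (IwasawaAlgebra 2) D.X)))
    (hup₂ : ∀ (κ : ZpExtension ℚ 2) (γ : Field.absoluteGaloisGroup ℚ), κ.IsCyclotomic →
      κ.IsTopGenerator γ → IsCyclotomicVariable 2 γ → ∀ D : W.SelmerDualData κ γ,
      Nat.card (D.X ⧸ (towerIdeal 2 2 • ⊤ : Submodule (IwasawaAlgebra 2) D.X)) ≤ 2 ^ n) :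
    MainConjectureLowerDivisibilityAtTwoOrd W := by
  have hord : IsOrdinaryAt W 2 := hgo
  refine mainConjectureLowerDivisibilityAtTwoOrd_of_towerGapAtTwo W h17 ?_
    (towerGapAtTwo_of_levelOne W hlow₁ hup₂)
  intro _ f hf ϖ hϖ
  exact exists_integral_mul_padicLFunction_two_of_padicValRat_nonneg W hord hf (hper₀ f hf ϖ hϖ)

/-- **The Kato–Néron half at `W` from a LAYER-PAIR count alone** (`2^a ≤ #X/(2,T^{2^j})X`,
`#X/(2,T^{2^{j+1}})X ≤ 2^b`, `b < 2^j + a`) + Kato 17.4 (1)(2)@2 + `hper₀`; no `λ`-side input.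
[cite: Kato2004Asterisque, Thm. 17.4 (1)(2) (p. 273)] [cite: MazurTateTeitelbaum1986Invent, §I.12] -/
theorem katoHalfAt_two_of_layerPair_counts
    (h17 : ∀ [NeZero (W.conductorNorm ℤ)] (f : CuspForm (Gamma0 (W.conductorNorm ℤ)) 2),
      kato_divisibility_allPrimes W 2 (f := f))
    (hper₀ : ∀ [NeZero (W.conductorNorm ℤ)] (f : CuspForm (Gamma0 (W.conductorNorm ℤ)) 2),
      IsNewformOf W f → ∀ ϖ : ℚ, (ϖ : ℝ) * W.realPeriodRat = plusPeriod f → 0 ≤ padicValRat 2 ϖ)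
    (hgo : GoodOrd W 2) {j a b : ℕ}
    (hlow : ∀ (κ : ZpExtension ℚ 2) (γ : Field.absoluteGaloisGroup ℚ), κ.IsCyclotomic →
      κ.IsTopGenerator γ → IsCyclotomicVariable 2 γ → ∀ D : W.SelmerDualData κ γ,
      2 ^ a ≤ Nat.card (D.X ⧸ (towerIdeal 2 (2 ^ j) • ⊤ : Submodule (IwasawaAlgebra 2) D.X)))
    (hup : ∀ (κ : ZpExtension ℚ 2) (γ : Field.absoluteGaloisGroup ℚ), κ.IsCyclotomic →
      κ.IsTopGenerator γ → IsCyclotomicVariable 2 γ → ∀ D : W.SelmerDualData κ γ,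
      Nat.card (D.X ⧸ (towerIdeal 2 (2 ^ (j + 1)) • ⊤ : Submodule (IwasawaAlgebra 2) D.X)) ≤ 2 ^ b)
    (hab : b < 2 ^ j + a) : MainConjectureLowerDivisibilityAtTwoOrd W := by
  have hord : IsOrdinaryAt W 2 := hgo
  refine mainConjectureLowerDivisibilityAtTwoOrd_of_towerGapAtTwo W h17 ?_
    (towerGapAtTwo_of_layerPair W hlow hup hab)
  intro _ f hf ϖ hϖ
  exact exists_integral_mul_padicLFunction_two_of_padicValRat_nonneg W hord hf (hper₀ f hf ϖ hϖ)

/-- **The item `OrdKatoHalfAtTwo` AT `W` from a `2`-descent over `ℚ` and ONE count at `ℚ(√2)`**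
(ADDENDUM, same seat): `2 ∤ #E(ℚ)_tors`, `2^n ≤ #Sel_{2^∞}(E/ℚ)[2]`, `#X/(2,T²)X ≤ 2^n` for every
cyclotomic datum, Kato 17.4 (1)(2)@2 and `hper₀` ⇒ `MainConjectureLowerDivisibilityAtTwoOrd W`. No
`λ_an`/`μ_an` certificate, no Prop. 4.14 (those enter only the IMC / `BSD(E,2)` doors above).
[cite: Kato2004Asterisque, Thm. 17.4 (1)(2) (p. 273)] [cite: GreenbergLNM1716, §1 p. 60 and §3 pp. 85–86] -/
theorem katoHalfAt_two_of_layerZero_of_levelOne_counts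
    (h17 : ∀ [NeZero (W.conductorNorm ℤ)] (f : CuspForm (Gamma0 (W.conductorNorm ℤ)) 2),
      kato_divisibility_allPrimes W 2 (f := f))
    (hper₀ : ∀ [NeZero (W.conductorNorm ℤ)] (f : CuspForm (Gamma0 (W.conductorNorm ℤ)) 2),
      IsNewformOf W f → ∀ ϖ : ℚ, (ϖ : ℝ) * W.realPeriodRat = plusPeriod f → 0 ≤ padicValRat 2 ϖ)
    (hgo : GoodOrd W 2) (htors : ¬ 2 ∣ W.torsionOrder) {n : ℕ}
    (hsel₀ : ∀ κ : ZpExtension ℚ 2, κ.IsCyclotomic →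
      2 ^ n ≤ Nat.card {z : W.selmerLayer κ 0 // 2 • z = 0})
    (hup₂ : ∀ (κ : ZpExtension ℚ 2) (γ : Field.absoluteGaloisGroup ℚ), κ.IsCyclotomic →
      κ.IsTopGenerator γ → IsCyclotomicVariable 2 γ → ∀ D : W.SelmerDualData κ γ,
      Nat.card (D.X ⧸ (towerIdeal 2 2 • ⊤ : Submodule (IwasawaAlgebra 2) D.X)) ≤ 2 ^ n) :
    MainConjectureLowerDivisibilityAtTwoOrd W :=
  katoHalfAt_two_of_levelOne_counts W h17 hper₀ hgo (towerLowOne_of_layerZero W htors hsel₀) hup₂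

end Curve

end Summit.BirchSwinnertonDyer.BirchSwinnertonDyer.Theorems.KatoHalfPinch

end
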